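import Literature.NumberTheory.Rogawski1990.AdelicStableOrbitalSupportFiniteH
import Literature.NumberTheory.Rogawski1990.AdelicStableClassSupportFinite
import Literature.LinearAlgebra.Matrix.RegularSemisimpleConjClassClosed
import HarnessLib

/-!
# Only finitely many `G`-regular stable classes of `H = U(Φ₂) × U(Φ₁)` are met by a compact set of `H`-adèles; the support of
# `𝒪′_st ↦ Φ^st_H(γ_H(𝒪′_st), f^H)` is finite for every `f^H ∈ C_c(H(𝐀))` and EVERY family of orbital measures
(Rogawski, *Automorphic representations of unitary groups in three variables* (1990), §5.4 pp. 72–73, §14.5 Thm. 14.5.1 (a) p. 238 «the sum is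
over the stable classes `𝒪′_st` in `H` which transfer to `𝒪_st`» — finitely many non-zero terms; Cassels–Fröhlich, Ch. II §14: `L ⊂ 𝔸_L` is discrete)

Topic `NumberTheory/Rogawski1990`; namespace `Literature.NumberTheory.Rogawski1990`; THEOREMS ONLY (no definition, no instance, no named fact, no
`sorry`).  The `H`-side twin of the `G = U(Φ₃)`-side file ★ `AdelicStableClassSupportFinite` (F0P2-p02 (g3), row (SF-st)), whose generic §1∕§3 lemmas it reuses; cell `pub/hodgecm-mathlib`,
ENGINE T1, ED 1.19c pin (xiii-f) «`∀ f^H, (Function.support fun 𝒪H => 𝔨.SJH 𝒪H f^H).Finite`».  ★ `AdelicStableOrbitalSupportFiniteH` (F0P3a-p08)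
proved finiteness WITHIN one adelic stable class `𝒞′_𝐀(γ_H)`; this file proves finiteness ACROSS the stable classes.

ROAD (charpoly through the adèle ring).  For an `H`-matching adèle `h = (h₂, h₁)` over the rational `γ_H = (γ₂, γ₁)` (★ `MatchingAdeleH L γH`:
componentwise stably conjugate to `(γ_H)_v` at every finite place and to `γ_H ⊗ 1` at infinity):
* §1 (pure algebra, any field `K`): `G`-regularity makes `γ₂` regular semisimple in `GL₂(K)` (★ `IsGRegular.isRegularElt_fst`), and two regular
  semisimple `2 × 2` matrices with the same characteristic polynomial are `GL₂(K)`-conjugate (★ `isConj_of_charpoly_eq_of_separable` of the `G`-side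
  sibling ★ `AdelicStableClassSupportFinite`, via the companion matrix); on `U(Φ₁) ⊂ GL₁` stable conjugacy is equality (★
  `isStablyConj_iff_eq_of_fin_one`).  Hence a `G`-regular stable class `𝒪′_st` of `H(L⁺)` is DETERMINED by the three scalars
  `(p_{γ₂}(0)-coefficient, p_{γ₂}(1)-coefficient, (γ₁)₀₀) ∈ L³` (★ `StableClassH.fst`, ★ `StableClass.charpoly`, ★ `StableClassH.sndVal`):
  `stableClassH_eq_of_coeff_charpoly_fst_eq_of_sndVal_eq`.
* §2 (adelic): the characteristic polynomial of `h₂ ∈ GL₂(𝔸_L)` IS `p_{γ₂} ⊗ 1` — coefficientwise `algebraMap L 𝔸_L` of the rational coefficients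
  (`MatchingAdeleH.coeff_charpoly_adele_fst_eq`): its finite components are read place by place (★ `adeleToLocal_apply`, every place `w` of `L` lies
  over `w ∩ 𝓞_{L⁺}`) from ★ `IsStablyConj.charpoly_eq` at `v`, its archimedean component through ★ `archHom` (Mathlib's `ringEquiv_mixedSpace`) from
  the archimedean stable conjugacy; and `h₁ = γ₁ ⊗ 1` (★ `MatchingAdeleH.adele_snd_eq`).  Both are continuous in `h` (★ `continuous_charpoly_coeff`).
* §3 HEAD **`finite_setOf_stableClassH_meets`**: for `C ⊂ H(𝐀)` compact, the `G`-regular stable classes `𝒪′_st(γ_H)` some class of whose adelic stable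
  class `𝒞′_𝐀(γ_H)` (★ `adelicStableClassesOverH`) meets `C` form a FINITE set — their three scalars lie in `{ξ ∈ L | ξ ⊗ 1 ∈ E}` for the compact
  coordinate images `E` of `C` (★ `finite_setOf_algebraMap_mem_of_isCompact` of the `G`-side sibling: `L` is discrete and closed in `𝔸_L`).
* §4 COROLLARY **`finite_setOf_stableClassH_adelicStableOrbitalIntegralH_ne_zero`**: for EVERY class-indexed family `m` of orbital measures on `H(𝐀)`
  and every `f^H` with compact support, `{𝒪′_st G-regular | Φ^st_H(γ_H(𝒪′_st), m, f^H) ≠ 0}` is finite (a non-zero `finsum` ★ `adelicStableOrbitalIntegralH`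
  has a non-zero class term, and that class meets `tsupport f^H`).  No Kottwitz fact, no normalisation, no measure hypothesis.

## References
* J. D. Rogawski, *Automorphic Representations of Unitary Groups in Three Variables*, Ann. of Math. Stud. 123 (1990), §3.1 p. 19, §5.4 pp. 72–73,
  §14.5 Thm. 14.5.1 (a) p. 238 [Rogawski1990].
* J. W. S. Cassels, A. Fröhlich (eds.), *Algebraic Number Theory* (1967), Ch. II §14 (`k` discrete in `𝔸_k`, `𝔸_k ∕ k` compact) [CasselsFrohlichANT1967].
* R. A. Horn, C. R. Johnson, *Matrix Analysis*, 2nd ed. (2013), Thm. 3.3.15, 3.3.P12 (non-derogatory matrices with equal characteristic polynomial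
  are similar) [HornJohnson2013].
-/
noncomputable section

open NumberField IsDedekindDomain Filter Topology Polynomial
open scoped MatrixGroups

namespace Literature.NumberTheory.Rogawski1990

open Literature.NumberTheory.Automorphic
open Literature.AlgebraicGeometry.ShimuraVarieties (unitaryGroup)
open Literature.LinearAlgebra.Matrix (continuous_charpoly_coeff)

/-! ## §1 A `G`-regular stable class of `H(F) = U(J₂)(K) × U(J₁)(K)` is determined by `(p_{γ₂}, γ₁)` -/

section Algebra

variable {K : Type*} [Field K] {σ : K →+* K} {J₂ : Matrix (Fin 2) (Fin 2) K} {J₁ : Matrix (Fin 1) (Fin 1) K}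

/-- **Regular semisimple with the same characteristic polynomial ⇒ stably conjugate** on `H(F) = U(J₂) × U(J₁)`: if `γ₂` is regular semisimple in
`GL₂(K)`, `p_{γ₂′} = p_{γ₂}` and `γ₁′ = γ₁`, then `(γ₂, γ₁) ∼_st (γ₂′, γ₁′)` (★ `isConj_of_charpoly_eq_of_separable`: both `γ₂`, `γ₂′` are `GL₂(K)`-conjugate to the
companion matrix of the common separable characteristic polynomial). [cite: Rogawski1990, §3.1 p. 19] [cite: HornJohnson2013, Thm 3.3.15, 3.3.P12] -/
theorem isStablyConjH_of_charpoly_fst_eq_of_snd_eq {a a' : unitaryGroup σ J₂ × unitaryGroup σ J₁} (hreg : IsRegularElt (a.1 : GL (Fin 2) K))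
    (h₁ : ((a'.1 : GL (Fin 2) K) : Matrix (Fin 2) (Fin 2) K).charpoly = ((a.1 : GL (Fin 2) K) : Matrix (Fin 2) (Fin 2) K).charpoly)
    (h₂ : a'.2 = a.2) : IsStablyConjH σ J₂ J₁ a a' :=
  ⟨isConj_of_charpoly_eq_of_separable _ _ hreg h₁.symm, h₂ ▸ IsStablyConj.refl _⟩

/-- A `1 × 1` invertible matrix is its entry. [folklore] -/
private theorem GL_fin_one_eq_of_apply_eq {x y : GL (Fin 1) K} (h : (x : Matrix (Fin 1) (Fin 1) K) 0 0 = (y : Matrix (Fin 1) (Fin 1) K) 0 0) : x = y := by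
  refine Units.ext (Matrix.ext fun i j => ?_)
  fin_cases i; fin_cases j
  exact h

/-- The characteristic polynomial of a `2 × 2` matrix over a field is determined by its coefficients in degrees `0` and `1` (it is monic of degree `2`).
[folklore] -/
private theorem charpoly_eq_of_coeff_zero_eq_of_coeff_one_eq {A B : Matrix (Fin 2) (Fin 2) K} (h0 : A.charpoly.coeff 0 = B.charpoly.coeff 0)
    (h1 : A.charpoly.coeff 1 = B.charpoly.coeff 1) : A.charpoly = B.charpoly := by
  have hdA : A.charpoly.natDegree = 2 := by rw [Matrix.charpoly_natDegree_eq_dim, Fintype.card_fin]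
  have hdB : B.charpoly.natDegree = 2 := by rw [Matrix.charpoly_natDegree_eq_dim, Fintype.card_fin]
  refine Polynomial.ext fun k => ?_
  rcases k with _ | _ | _ | k
  · exact h0
  · exact h1
  · have hA2 : A.charpoly.coeff 2 = 1 := by simpa [hdA] using (Matrix.charpoly_monic A).coeff_natDegree
    have hB2 : B.charpoly.coeff 2 = 1 := by simpa [hdB] using (Matrix.charpoly_monic B).coeff_natDegree
    rw [hA2, hB2]
  · rw [Polynomial.coeff_eq_zero_of_natDegree_lt (by omega), Polynomial.coeff_eq_zero_of_natDegree_lt (by omega)]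

/-- **A `G`-regular stable class of `H(F)` is determined by three scalars**: if `𝒪′ = 𝒪′_st(γ_H)` with `γ₂` regular semisimple in `GL₂(K)`, and
`𝒪″` has the same `U(J₂)`-characteristic-polynomial coefficients in degrees `0`, `1` (★ `StableClassH.fst`, ★ `StableClass.charpoly`) and the
same `U(J₁)`-scalar (★ `StableClassH.sndVal`), then `𝒪′ = 𝒪″`. [cite: Rogawski1990, §3.1 p. 19] [cite: HornJohnson2013, 3.3.P12] -/
theorem stableClassH_eq_of_coeff_charpoly_fst_eq_of_sndVal_eq {𝒪 𝒪' : StableClassH σ J₂ J₁}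
    (h𝒪 : ∃ a : unitaryGroup σ J₂ × unitaryGroup σ J₁, stableClassHOf σ J₂ J₁ a = 𝒪 ∧ IsRegularElt (a.1 : GL (Fin 2) K))
    (h0 : 𝒪.fst.charpoly.coeff 0 = 𝒪'.fst.charpoly.coeff 0) (h1 : 𝒪.fst.charpoly.coeff 1 = 𝒪'.fst.charpoly.coeff 1)
    (hs : 𝒪.sndVal = 𝒪'.sndVal) : 𝒪 = 𝒪' := by
  obtain ⟨a, rfl, hreg⟩ := h𝒪
  obtain ⟨a', rfl⟩ := stableClassHOf_surjective 𝒪'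
  simp only [StableClassH.fst_stableClassHOf, StableClass.charpoly_stableClassOf, StableClassH.sndVal_stableClassHOf] at h0 h1 hs
  exact stableClassHOf_eq_iff.mpr (isStablyConjH_of_charpoly_fst_eq_of_snd_eq hreg (charpoly_eq_of_coeff_zero_eq_of_coeff_one_eq h0 h1).symm
    (Subtype.ext (GL_fin_one_eq_of_apply_eq hs.symm)))

end Algebra

/-! ## §2 The adelic invariants of an `H`-matching adèle: `p_{h₂} = p_{γ₂} ⊗ 1` and `h₁ = γ₁ ⊗ 1` -/

section Adelic

variable {L : Type} [Field L] [NumberField L] [IsCMField L]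

omit [IsCMField L] in
/-- **An adèle is determined by its archimedean part and its components above every finite place of `L⁺`** (★ `archHom`, ★ `adeleToLocal_apply`;
every finite place `w` of `L` lies over `w ∩ 𝓞_{L⁺}`). [cite: CasselsFrohlichANT1967, Ch. II §14] -/
theorem AdeleRing.eq_of_archHom_eq_of_forall_adeleToLocal_eq {a b : AdeleRing (𝓞 L) L} (h₁ : archHom L a = archHom L b)
    (h₂ : ∀ v : HeightOneSpectrum (𝓞 ↥(maximalRealSubfield L)), UnitaryGroup.adeleToLocal L v a = UnitaryGroup.adeleToLocal L v b) : a = b := by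
  have h₁' : InfiniteAdeleRing.ringEquiv_mixedSpace L a.1 = InfiniteAdeleRing.ringEquiv_mixedSpace L b.1 := h₁
  refine Prod.ext ((InfiniteAdeleRing.ringEquiv_mixedSpace L).injective h₁') (RestrictedProduct.ext _ _ fun w => ?_)
  have h := congrFun (h₂ (w.under (𝓞 ↥(maximalRealSubfield L)))) ⟨w, rfl⟩
  rwa [UnitaryGroup.adeleToLocal_apply, UnitaryGroup.adeleToLocal_apply] at h

omit [IsCMField L] in
/-- Polynomial form: a polynomial over `𝔸_L` is determined by its images under the archimedean projection ★ `archHom` and under all the local projections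
★ `adeleToLocal v`. [cite: CasselsFrohlichANT1967, Ch. II §14] -/
theorem Polynomial.eq_of_map_archHom_eq_of_forall_map_adeleToLocal_eq {p q : (AdeleRing (𝓞 L) L)[X]} (h₁ : p.map (archHom L) = q.map (archHom L))
    (h₂ : ∀ v : HeightOneSpectrum (𝓞 ↥(maximalRealSubfield L)), p.map (UnitaryGroup.adeleToLocal L v) = q.map (UnitaryGroup.adeleToLocal L v)) :
    p = q := by
  refine Polynomial.ext fun k => AdeleRing.eq_of_archHom_eq_of_forall_adeleToLocal_eq ?_ fun v => ?_
  · simpa only [Polynomial.coeff_map] using congrArg (fun r => r.coeff k) h₁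
  · simpa only [Polynomial.coeff_map] using congrArg (fun r => r.coeff k) (h₂ v)

omit [IsCMField L] in
/-- `mixedEmbedding = archHom ∘ (L → 𝔸_L)` as ring homomorphisms (Mathlib `InfiniteAdeleRing.mixedEmbedding_eq_algebraMap_comp`). [folklore] -/
private theorem mixedEmbedding_eq_archHom_comp_algebraMap :
    (mixedEmbedding L : L →+* mixedEmbedding.mixedSpace L) = (archHom L).comp (algebraMap L (AdeleRing (𝓞 L) L)) := by
  refine RingHom.ext fun x => ?_
  rw [InfiniteAdeleRing.mixedEmbedding_eq_algebraMap_comp]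
  rfl

omit [IsCMField L] in
/-- `(q ⊗ 1)_∞ = q` read in `(L ⊗ ℝ)[X]`: `(q.map (L → 𝔸_L)).map archHom = q.map mixedEmbedding`. [folklore] -/
private theorem Polynomial.map_algebraMap_map_archHom (q : L[X]) :
    (q.map (algebraMap L (AdeleRing (𝓞 L) L))).map (archHom L) = q.map (mixedEmbedding L) := by
  rw [Polynomial.map_map, ← mixedEmbedding_eq_archHom_comp_algebraMap]

omit [IsCMField L] in
/-- `(q ⊗ 1)_v = q ⊗ 1` read in `(L ⊗ L⁺_v)[X]`: `(q.map (L → 𝔸_L)).map (adeleToLocal v) = q.map (L → L ⊗ L⁺_v)` (★ `adeleToLocal_comp_algebraMap`). [folklore] -/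
private theorem Polynomial.map_algebraMap_map_adeleToLocal (v : HeightOneSpectrum (𝓞 ↥(maximalRealSubfield L))) (q : L[X]) :
    (q.map (algebraMap L (AdeleRing (𝓞 L) L))).map (UnitaryGroup.adeleToLocal L v) = q.map (algebraMap L (UnitaryGroup.LocalRing L v)) := by
  rw [Polynomial.map_map, UnitaryGroup.adeleToLocal_comp_algebraMap]

variable {N : ℕ} (H : Matrix (Fin N) (Fin N) L)

/-- The characteristic polynomial of the archimedean component `g_∞ ∈ GL_N(L ⊗ ℝ)` of `g ∈ U(H)(𝔸)` is `p_g` read through ★ `archHom` (★ `coe_archPart`,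
★ `GLn.toMixed_apply` — definitional — and `Matrix.charpoly_map`). [cite: BorelJacquet1979, §4.1] -/
theorem charpoly_archPart_eq_map (g : ↥(adelicUnitaryGroup L H)) :
    ((UnitaryGroup.archPart (↥(maximalRealSubfield L)) L (IsCMField.complexConj L) N H g : GL (Fin N) (mixedEmbedding.mixedSpace L)) :
        Matrix (Fin N) (Fin N) (mixedEmbedding.mixedSpace L)).charpoly =
      ((g : GL (Fin N) (AdeleRing (𝓞 L) L)) : Matrix (Fin N) (Fin N) (AdeleRing (𝓞 L) L)).charpoly.map (archHom L) :=
  Matrix.charpoly_map ((g : GL (Fin N) (AdeleRing (𝓞 L) L)) : Matrix (Fin N) (Fin N) (AdeleRing (𝓞 L) L)) (archHom L)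

/-- The characteristic polynomial of `γ ⊗ 1 ∈ GL_N(L ⊗ ℝ)` (★ `cmRationalToArch`) is `p_γ` read through `mixedEmbedding` (★ `coe_cmRationalToArch`, ★
`coe_rationalToArch` — definitional). [cite: BorelJacquet1979, §4.1] -/
theorem charpoly_cmRationalToArch_eq_map (γ : (UnitaryGroup.cmDatum L N H).Rational) :
    ((cmRationalToArch L N H γ : GL (Fin N) (mixedEmbedding.mixedSpace L)) : Matrix (Fin N) (Fin N) (mixedEmbedding.mixedSpace L)).charpoly =
      (((γ : unitaryGroup (cmConjRingHom L) H).val : GL (Fin N) L) : Matrix (Fin N) (Fin N) L).charpoly.map (mixedEmbedding L) :=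
  Matrix.charpoly_map (((γ : unitaryGroup (cmConjRingHom L) H).val : GL (Fin N) L) : Matrix (Fin N) (Fin N) L) (mixedEmbedding L)

/-- The characteristic polynomial of the local component `g_v` of `g ∈ U(H)(𝔸)` is `p_g` read through ★ `adeleToLocal v` (★ `coe_cmDatum_toLocal` —
definitional — and `Matrix.charpoly_map`). [cite: PlatonovRapinchuk1994, §5.1] -/
theorem charpoly_toLocal_eq_map (v : HeightOneSpectrum (𝓞 ↥(maximalRealSubfield L))) (g : ↥(adelicUnitaryGroup L H)) :
    ((((UnitaryGroup.cmDatum L N H).toLocal v g).val : GL (Fin N) (UnitaryGroup.LocalRing L v)) : Matrix (Fin N) (Fin N) (UnitaryGroup.LocalRing L v)).charpoly =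
      ((g : GL (Fin N) (AdeleRing (𝓞 L) L)) : Matrix (Fin N) (Fin N) (AdeleRing (𝓞 L) L)).charpoly.map (UnitaryGroup.adeleToLocal L v) :=
  Matrix.charpoly_map ((g : GL (Fin N) (AdeleRing (𝓞 L) L)) : Matrix (Fin N) (Fin N) (AdeleRing (𝓞 L) L)) (UnitaryGroup.adeleToLocal L v)

/-- The characteristic polynomial of the diagonal image `γ ⊗ 1 ∈ U(H)(𝔸)` is `p_γ ⊗ 1` (★ `coe_cmDatum_toAdelic` — definitional — and
`Matrix.charpoly_map`). [cite: BorelJacquet1979, §4.1] -/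
theorem charpoly_toAdelic_eq_map (γ : (UnitaryGroup.cmDatum L N H).Rational) :
    ((((UnitaryGroup.cmDatum L N H).toAdelic γ).val : GL (Fin N) (AdeleRing (𝓞 L) L)) : Matrix (Fin N) (Fin N) (AdeleRing (𝓞 L) L)).charpoly =
      (((γ : unitaryGroup (cmConjRingHom L) H).val : GL (Fin N) L) : Matrix (Fin N) (Fin N) L).charpoly.map (algebraMap L (AdeleRing (𝓞 L) L)) :=
  Matrix.charpoly_map (((γ : unitaryGroup (cmConjRingHom L) H).val : GL (Fin N) L) : Matrix (Fin N) (Fin N) L) (algebraMap L (AdeleRing (𝓞 L) L))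

/-- The characteristic polynomial of `γ_v = (γ ⊗ 1)_v` is `p_γ ⊗ 1` (`charpoly_toLocal_eq_map` at `γ ⊗ 1`, `charpoly_toAdelic_eq_map`, ★ `adeleToLocal_comp_algebraMap`). [cite: PlatonovRapinchuk1994, §5.1] -/
theorem charpoly_toLocal_toAdelic_eq_map (v : HeightOneSpectrum (𝓞 ↥(maximalRealSubfield L))) (γ : (UnitaryGroup.cmDatum L N H).Rational) :
    ((((UnitaryGroup.cmDatum L N H).toLocal v ((UnitaryGroup.cmDatum L N H).toAdelic γ)).val : GL (Fin N) (UnitaryGroup.LocalRing L v)) :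
        Matrix (Fin N) (Fin N) (UnitaryGroup.LocalRing L v)).charpoly =
      (((γ : unitaryGroup (cmConjRingHom L) H).val : GL (Fin N) L) : Matrix (Fin N) (Fin N) L).charpoly.map (algebraMap L (UnitaryGroup.LocalRing L v)) := by
  rw [charpoly_toLocal_eq_map H v ((UnitaryGroup.cmDatum L N H).toAdelic γ), charpoly_toAdelic_eq_map, Polynomial.map_algebraMap_map_adeleToLocal]

/-- The adelic matrix of `γ ⊗ 1 ∈ U(H)(𝔸)` is the entrywise diagonal image (★ `coe_cmDatum_toAdelic` — definitional). [cite: BorelJacquet1979, §4.1] -/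
theorem coe_coe_cmDatum_toAdelic_apply (γ : (UnitaryGroup.cmDatum L N H).Rational) (i j : Fin N) :
    ((((UnitaryGroup.cmDatum L N H).toAdelic γ).val : GL (Fin N) (AdeleRing (𝓞 L) L)) : Matrix (Fin N) (Fin N) (AdeleRing (𝓞 L) L)) i j =
      algebraMap L (AdeleRing (𝓞 L) L) ((((γ : unitaryGroup (cmConjRingHom L) H).val : GL (Fin N) L) : Matrix (Fin N) (Fin N) L) i j) :=
  rfl

variable {γH : (UnitaryGroup.cmDatum L 2 (Matrix.of fun i j : Fin 2 => if i.val + j.val + 1 = 2 then (1 : L) else 0)).Rational ×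
  (UnitaryGroup.cmDatum L 1 (Matrix.of fun i j : Fin 1 => if i.val + j.val + 1 = 1 then (1 : L) else 0)).Rational}

/-- **`p_{h₂} = p_{γ₂} ⊗ 1` for an `H`-matching adèle `h = (h₂, h₁)` over `γ_H = (γ₂, γ₁)`**: the characteristic polynomial of the `U(Φ₂)(𝔸)`-component
is the base change of the rational one — finite components from the local stable conjugacies (★ `IsStablyConj.charpoly_eq` at `(γ_H)_v`, ★ `rationalComponent`),
archimedean component from the archimedean one (★ `rationalArch`). [cite: Rogawski1990, §3.3 p. 21; §5.4 p. 72] -/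
theorem MatchingAdeleH.charpoly_adele_fst_eq (p : MatchingAdeleH L γH) :
    ((p.adele.1.val : GL (Fin 2) (AdeleRing (𝓞 L) L)) : Matrix (Fin 2) (Fin 2) (AdeleRing (𝓞 L) L)).charpoly =
      (((γH.1 : unitaryGroup (cmConjRingHom L) (Matrix.of fun i j : Fin 2 => if i.val + j.val + 1 = 2 then (1 : L) else 0)).val : GL (Fin 2) L) :
        Matrix (Fin 2) (Fin 2) L).charpoly.map (algebraMap L (AdeleRing (𝓞 L) L)) := by
  refine Polynomial.eq_of_map_archHom_eq_of_forall_map_adeleToLocal_eq ?_ fun v => ?_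
  · -- archimedean component
    have ha := (p.isArchStablyConjH).1.charpoly_eq
    have h1 := charpoly_archPart_eq_map (Matrix.of fun i j : Fin 2 => if i.val + j.val + 1 = 2 then (1 : L) else 0) p.adele.1
    have h2 := charpoly_cmRationalToArch_eq_map (Matrix.of fun i j : Fin 2 => if i.val + j.val + 1 = 2 then (1 : L) else 0) γH.1
    have h3 := Polynomial.map_algebraMap_map_archHom
      (((γH.1 : unitaryGroup (cmConjRingHom L) (Matrix.of fun i j : Fin 2 => if i.val + j.val + 1 = 2 then (1 : L) else 0)).val : GL (Fin 2) L) :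
        Matrix (Fin 2) (Fin 2) L).charpoly
    exact h1.symm.trans (ha.symm.trans (h2.trans h3.symm))
  · -- component above the finite place `v` of `L⁺`
    have hv := (p.isLocalStablyConjH v).1.charpoly_eq
    have h1 := charpoly_toLocal_eq_map (Matrix.of fun i j : Fin 2 => if i.val + j.val + 1 = 2 then (1 : L) else 0) v p.adele.1
    have h2 := charpoly_toLocal_toAdelic_eq_map (Matrix.of fun i j : Fin 2 => if i.val + j.val + 1 = 2 then (1 : L) else 0) v γH.1
    have h3 := Polynomial.map_algebraMap_map_adeleToLocal v
      (((γH.1 : unitaryGroup (cmConjRingHom L) (Matrix.of fun i j : Fin 2 => if i.val + j.val + 1 = 2 then (1 : L) else 0)).val : GL (Fin 2) L) :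
        Matrix (Fin 2) (Fin 2) L).charpoly
    exact h1.symm.trans (hv.symm.trans (h2.trans h3.symm))

/-- Coefficientwise: `(p_{h₂})_k = (p_{γ₂})_k ⊗ 1`. [cite: Rogawski1990, §5.4 p. 72] -/
theorem MatchingAdeleH.coeff_charpoly_adele_fst_eq (p : MatchingAdeleH L γH) (k : ℕ) :
    ((p.adele.1.val : GL (Fin 2) (AdeleRing (𝓞 L) L)) : Matrix (Fin 2) (Fin 2) (AdeleRing (𝓞 L) L)).charpoly.coeff k =
      algebraMap L (AdeleRing (𝓞 L) L)
        ((((γH.1 : unitaryGroup (cmConjRingHom L) (Matrix.of fun i j : Fin 2 => if i.val + j.val + 1 = 2 then (1 : L) else 0)).val : GL (Fin 2) L) :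
          Matrix (Fin 2) (Fin 2) L).charpoly.coeff k) := by
  have h := congrArg (fun r => r.coeff k) p.charpoly_adele_fst_eq
  simpa only [Polynomial.coeff_map] using h

/-- **`h₁ = γ₁ ⊗ 1` entrywise**: the `U(Φ₁)(𝔸)`-component of an `H`-matching adèle is the diagonal image of `γ₁` (★ `MatchingAdeleH.adele_snd_eq`).
[cite: Rogawski1990, §3.1 p. 19; §5.4 p. 72] -/
theorem MatchingAdeleH.adele_snd_apply_eq (p : MatchingAdeleH L γH) :
    ((p.adele.2.val : GL (Fin 1) (AdeleRing (𝓞 L) L)) : Matrix (Fin 1) (Fin 1) (AdeleRing (𝓞 L) L)) 0 0 =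
      algebraMap L (AdeleRing (𝓞 L) L)
        ((((γH.2 : unitaryGroup (cmConjRingHom L) (Matrix.of fun i j : Fin 1 => if i.val + j.val + 1 = 1 then (1 : L) else 0)).val : GL (Fin 1) L) :
          Matrix (Fin 1) (Fin 1) L) 0 0) := by
  have h := congrArg (fun g : (UnitaryGroup.cmDatum L 1 (Matrix.of fun i j : Fin 1 => if i.val + j.val + 1 = 1 then (1 : L) else 0)).Adelic =>
    ((g.val : GL (Fin 1) (AdeleRing (𝓞 L) L)) : Matrix (Fin 1) (Fin 1) (AdeleRing (𝓞 L) L)) 0 0) p.adele_snd_eq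
  exact h.trans (coe_coe_cmDatum_toAdelic_apply _ γH.2 0 0)

/-- `h ↦ (p_{h₂})_k` is continuous on `H(𝐀)` (★ `continuous_charpoly_coeff`). [folklore] -/
private theorem continuous_coeff_charpoly_fst (k : ℕ) :
    Continuous fun h : (UnitaryGroup.cmDatum L 2 (Matrix.of fun i j : Fin 2 => if i.val + j.val + 1 = 2 then (1 : L) else 0)).Adelic ×
        (UnitaryGroup.cmDatum L 1 (Matrix.of fun i j : Fin 1 => if i.val + j.val + 1 = 1 then (1 : L) else 0)).Adelic =>
      ((h.1.val : GL (Fin 2) (AdeleRing (𝓞 L) L)) : Matrix (Fin 2) (Fin 2) (AdeleRing (𝓞 L) L)).charpoly.coeff k :=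
  (continuous_charpoly_coeff k).comp (Units.continuous_val.comp (continuous_subtype_val.comp continuous_fst))

/-- `h ↦ (h₁)₀₀` is continuous on `H(𝐀)`. [folklore] -/
private theorem continuous_snd_apply :
    Continuous fun h : (UnitaryGroup.cmDatum L 2 (Matrix.of fun i j : Fin 2 => if i.val + j.val + 1 = 2 then (1 : L) else 0)).Adelic ×
        (UnitaryGroup.cmDatum L 1 (Matrix.of fun i j : Fin 1 => if i.val + j.val + 1 = 1 then (1 : L) else 0)).Adelic =>
      ((h.2.val : GL (Fin 1) (AdeleRing (𝓞 L) L)) : Matrix (Fin 1) (Fin 1) (AdeleRing (𝓞 L) L)) 0 0 :=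
  (Units.continuous_val.comp (continuous_subtype_val.comp continuous_snd)).matrix_elem 0 0

/-! ## §3 Only finitely many `G`-regular stable classes of `H` are met by a compact set of adèles -/

/-- **Only finitely many `G`-regular stable classes `𝒪′_st ⊂ H(L⁺)` have an adelic stable class `𝒞′_𝐀(γ_H)` some member of which meets a given compact
`C ⊂ H(𝐀) = U(Φ₂)(𝔸) × U(Φ₁)(𝔸)`.**  The three rational scalars `((p_{γ₂})₀, (p_{γ₂})₁, (γ₁)₀₀)` of such a class are read off any `h ∈ C` in its adelic
stable class (§2) and therefore lie in the finite sets `{ξ ∈ L | ξ ⊗ 1 ∈ E}`, `E` the (compact) coordinate images of `C` (★ `finite_setOf_algebraMap_mem_of_isCompact`);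
and they determine the class (§1). [cite: Rogawski1990, §5.4 pp. 72–73; §14.5 Thm. 14.5.1 (a) p. 238] [cite: CasselsFrohlichANT1967, Ch. II §14] -/
theorem finite_setOf_stableClassH_meets
    {C : Set ((UnitaryGroup.cmDatum L 2 (Matrix.of fun i j : Fin 2 => if i.val + j.val + 1 = 2 then (1 : L) else 0)).Adelic ×
      (UnitaryGroup.cmDatum L 1 (Matrix.of fun i j : Fin 1 => if i.val + j.val + 1 = 1 then (1 : L) else 0)).Adelic)} (hC : IsCompact C) :
    {𝒪H : StableClassH (cmConjRingHom L) (Matrix.of fun i j : Fin 2 => if i.val + j.val + 1 = 2 then (1 : L) else 0)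
        (Matrix.of fun i j : Fin 1 => if i.val + j.val + 1 = 1 then (1 : L) else 0) |
      ∃ γH : (UnitaryGroup.cmDatum L 2 (Matrix.of fun i j : Fin 2 => if i.val + j.val + 1 = 2 then (1 : L) else 0)).Rational ×
          (UnitaryGroup.cmDatum L 1 (Matrix.of fun i j : Fin 1 => if i.val + j.val + 1 = 1 then (1 : L) else 0)).Rational,
        stableClassHOf (cmConjRingHom L) _ _ γH = 𝒪H ∧
          IsGRegular (cmConjRingHom L) (Matrix.of fun i j : Fin 2 => if i.val + j.val + 1 = 2 then (1 : L) else 0)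
            (Matrix.of fun i j : Fin 1 => if i.val + j.val + 1 = 1 then (1 : L) else 0)
            (Matrix.of fun i j : Fin 3 => if i.val + j.val + 1 = 3 then (1 : L) else 0) endoForm_antidiagOne γH ∧
          ∃ c ∈ adelicStableClassesOverH L γH, ∃ h ∈ C, ConjClasses.mk h = c}.Finite := by
  classical
  -- the finite sets of rational scalars whose diagonal image lies in a coordinate image of `C`
  have hF : ∀ {φ : (UnitaryGroup.cmDatum L 2 (Matrix.of fun i j : Fin 2 => if i.val + j.val + 1 = 2 then (1 : L) else 0)).Adelic ×
        (UnitaryGroup.cmDatum L 1 (Matrix.of fun i j : Fin 1 => if i.val + j.val + 1 = 1 then (1 : L) else 0)).Adelic → AdeleRing (𝓞 L) L},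
      Continuous φ → {ξ : L | algebraMap L (AdeleRing (𝓞 L) L) ξ ∈ φ '' C}.Finite :=
    fun hφ => finite_setOf_algebraMap_mem_of_isCompact (hC.image hφ)
  have hF₀ := hF (continuous_coeff_charpoly_fst (L := L) 0)
  have hF₁ := hF (continuous_coeff_charpoly_fst (L := L) 1)
  have hF₂ := hF (continuous_snd_apply (L := L))
  -- the three scalars of a stable class
  let Ψ : StableClassH (cmConjRingHom L) (Matrix.of fun i j : Fin 2 => if i.val + j.val + 1 = 2 then (1 : L) else 0)
      (Matrix.of fun i j : Fin 1 => if i.val + j.val + 1 = 1 then (1 : L) else 0) → L × L × L :=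
    fun 𝒪 => (𝒪.fst.charpoly.coeff 0, 𝒪.fst.charpoly.coeff 1, 𝒪.sndVal)
  refine Set.Finite.of_finite_image (f := Ψ) ((hF₀.prod (hF₁.prod hF₂)).subset ?_) ?_
  · -- the scalars of a class in the set lie in the finite sets
    rintro _ ⟨𝒪, ⟨γH, rfl, hreg, c, hc, h, hhC, hh⟩, rfl⟩
    obtain ⟨q, hq⟩ := exists_matchingAdeleH_adele_eq_of_mem hc hh
    subst hq
    simp only [Set.mem_prod, Set.mem_setOf_eq, Ψ, StableClassH.fst_stableClassHOf, StableClass.charpoly_stableClassOf,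
      StableClassH.sndVal_stableClassHOf]
    exact ⟨⟨q.adele, hhC, q.coeff_charpoly_adele_fst_eq 0⟩, ⟨q.adele, hhC, q.coeff_charpoly_adele_fst_eq 1⟩, ⟨q.adele, hhC, q.adele_snd_apply_eq⟩⟩
  · -- the scalars determine the class
    rintro 𝒪 ⟨γH, h𝒪, hreg, -⟩ 𝒪' - hΨ
    simp only [Ψ, Prod.mk.injEq] at hΨ
    exact stableClassH_eq_of_coeff_charpoly_fst_eq_of_sndVal_eq ⟨γH, h𝒪, hreg.isRegularElt_fst⟩ hΨ.1 hΨ.2.1 hΨ.2.2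

/-! ## §4 The support of `𝒪′_st ↦ Φ^st_H(γ_H(𝒪′_st), f^H)` on the `G`-regular classes is finite -/

variable [∀ h : (UnitaryGroup.cmDatum L 2 (Matrix.of fun i j : Fin 2 => if i.val + j.val + 1 = 2 then (1 : L) else 0)).Adelic ×
    (UnitaryGroup.cmDatum L 1 (Matrix.of fun i j : Fin 1 => if i.val + j.val + 1 = 1 then (1 : L) else 0)).Adelic,
  MeasurableSpace (((UnitaryGroup.cmDatum L 2 (Matrix.of fun i j : Fin 2 => if i.val + j.val + 1 = 2 then (1 : L) else 0)).Adelic ×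
      (UnitaryGroup.cmDatum L 1 (Matrix.of fun i j : Fin 1 => if i.val + j.val + 1 = 1 then (1 : L) else 0)).Adelic) ⧸
    Subgroup.centralizer ({h} : Set ((UnitaryGroup.cmDatum L 2 (Matrix.of fun i j : Fin 2 => if i.val + j.val + 1 = 2 then (1 : L) else 0)).Adelic ×
      (UnitaryGroup.cmDatum L 1 (Matrix.of fun i j : Fin 1 => if i.val + j.val + 1 = 1 then (1 : L) else 0)).Adelic)))]

/-- A non-zero class orbital integral forces the class to meet the topological support of the test function (★ `classOrbitalIntegral_eq`, ★
`orbitalIntegral_eq_zero_of_forall_notMem_tsupport`). [cite: Rogawski1990, §4.3 p. 44] -/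
theorem exists_mem_tsupport_mk_eq_of_classOrbitalIntegral_ne_zero
    (m : OrbitalMeasureFamily ((UnitaryGroup.cmDatum L 2 (Matrix.of fun i j : Fin 2 => if i.val + j.val + 1 = 2 then (1 : L) else 0)).Adelic ×
      (UnitaryGroup.cmDatum L 1 (Matrix.of fun i j : Fin 1 => if i.val + j.val + 1 = 1 then (1 : L) else 0)).Adelic))
    {E : Type*} [NormedAddCommGroup E] [NormedSpace ℝ E]
    {fH : (UnitaryGroup.cmDatum L 2 (Matrix.of fun i j : Fin 2 => if i.val + j.val + 1 = 2 then (1 : L) else 0)).Adelic ×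
      (UnitaryGroup.cmDatum L 1 (Matrix.of fun i j : Fin 1 => if i.val + j.val + 1 = 1 then (1 : L) else 0)).Adelic → E}
    {c : ConjClasses ((UnitaryGroup.cmDatum L 2 (Matrix.of fun i j : Fin 2 => if i.val + j.val + 1 = 2 then (1 : L) else 0)).Adelic ×
      (UnitaryGroup.cmDatum L 1 (Matrix.of fun i j : Fin 1 => if i.val + j.val + 1 = 1 then (1 : L) else 0)).Adelic)}
    (hne : classOrbitalIntegral m fH c ≠ 0) : ∃ h ∈ tsupport fH, ConjClasses.mk h = c := by
  by_contra hno
  refine hne ?_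
  rw [classOrbitalIntegral_eq]
  refine orbitalIntegral_eq_zero_of_forall_notMem_tsupport _ _ fun g hg => hno ⟨g * Quotient.out c * g⁻¹, hg, ?_⟩
  rw [← ConjClasses.mk_eq_mk_iff_isConj.2 (isConj_iff.2 ⟨g, rfl⟩), ← ConjClasses.quotient_mk_eq_mk, Quotient.out_eq]

/-- **The support of `𝒪′_st ↦ Φ^st_H(γ_H(𝒪′_st), m, f^H)` on the `G`-regular stable classes of `H(L⁺)` is FINITE** — for EVERY class-indexed family `m`
of orbital measures on `H(𝐀)` and every `f^H` with compact support: a non-zero `Φ^st_H = Σᶠ_{𝒞′_𝐀(γ_H)} Φ(δ, f^H)` (★ `adelicStableOrbitalIntegralH`) has a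
non-zero class term, that class meets `tsupport f^H`, and §3 applies with `C := tsupport f^H`.  This is the shape of the engine line's pin (xiii-f)
«`Function.support (𝒪H ↦ SJH 𝒪H f^H)` finite» once `SJH` vanishes off the `G`-regular classes. [cite: Rogawski1990, §5.4 pp. 72–73; §14.5 Thm. 14.5.1 (a) p. 238] -/
theorem finite_setOf_stableClassH_adelicStableOrbitalIntegralH_ne_zero
    (m : OrbitalMeasureFamily ((UnitaryGroup.cmDatum L 2 (Matrix.of fun i j : Fin 2 => if i.val + j.val + 1 = 2 then (1 : L) else 0)).Adelic ×
      (UnitaryGroup.cmDatum L 1 (Matrix.of fun i j : Fin 1 => if i.val + j.val + 1 = 1 then (1 : L) else 0)).Adelic))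
    {fH : (UnitaryGroup.cmDatum L 2 (Matrix.of fun i j : Fin 2 => if i.val + j.val + 1 = 2 then (1 : L) else 0)).Adelic ×
      (UnitaryGroup.cmDatum L 1 (Matrix.of fun i j : Fin 1 => if i.val + j.val + 1 = 1 then (1 : L) else 0)).Adelic → ℂ}
    (hf : HasCompactSupport fH) :
    {𝒪H : StableClassH (cmConjRingHom L) (Matrix.of fun i j : Fin 2 => if i.val + j.val + 1 = 2 then (1 : L) else 0)
        (Matrix.of fun i j : Fin 1 => if i.val + j.val + 1 = 1 then (1 : L) else 0) |
      ∃ γH : (UnitaryGroup.cmDatum L 2 (Matrix.of fun i j : Fin 2 => if i.val + j.val + 1 = 2 then (1 : L) else 0)).Rational ×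
          (UnitaryGroup.cmDatum L 1 (Matrix.of fun i j : Fin 1 => if i.val + j.val + 1 = 1 then (1 : L) else 0)).Rational,
        stableClassHOf (cmConjRingHom L) _ _ γH = 𝒪H ∧
          IsGRegular (cmConjRingHom L) (Matrix.of fun i j : Fin 2 => if i.val + j.val + 1 = 2 then (1 : L) else 0)
            (Matrix.of fun i j : Fin 1 => if i.val + j.val + 1 = 1 then (1 : L) else 0)
            (Matrix.of fun i j : Fin 3 => if i.val + j.val + 1 = 3 then (1 : L) else 0) endoForm_antidiagOne γH ∧
          adelicStableOrbitalIntegralH L γH m fH ≠ 0}.Finite := by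
  refine (finite_setOf_stableClassH_meets (L := L) hf.isCompact).subset ?_
  rintro 𝒪H ⟨γH, h𝒪, hreg, hne⟩
  refine ⟨γH, h𝒪, hreg, ?_⟩
  -- a non-zero `finsum` over `𝒞′_𝐀(γ_H)` has a non-zero term
  obtain ⟨c, hc, hcne⟩ : ∃ c ∈ adelicStableClassesOverH L γH, classOrbitalIntegral m fH c ≠ 0 := by
    by_contra hall
    push Not at hall
    exact hne (by rw [adelicStableOrbitalIntegralH_def]; exact finsum_mem_of_eqOn_zero hall)
  obtain ⟨h, hh, hhc⟩ := exists_mem_tsupport_mk_eq_of_classOrbitalIntegral_ne_zero m hcne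
  exact ⟨c, hc, h, hh, hhc⟩

/-- The same for `f^H ∈ C_c(H(𝐀), ℂ)`. [cite: Rogawski1990, §5.4 pp. 72–73; §14.5 Thm. 14.5.1 (a) p. 238] -/
theorem finite_setOf_stableClassH_adelicStableOrbitalIntegralH_ne_zero_cc
    (m : OrbitalMeasureFamily ((UnitaryGroup.cmDatum L 2 (Matrix.of fun i j : Fin 2 => if i.val + j.val + 1 = 2 then (1 : L) else 0)).Adelic ×
      (UnitaryGroup.cmDatum L 1 (Matrix.of fun i j : Fin 1 => if i.val + j.val + 1 = 1 then (1 : L) else 0)).Adelic))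
    (fH : CompactlySupportedContinuousMap ((UnitaryGroup.cmDatum L 2 (Matrix.of fun i j : Fin 2 => if i.val + j.val + 1 = 2 then (1 : L) else 0)).Adelic ×
      (UnitaryGroup.cmDatum L 1 (Matrix.of fun i j : Fin 1 => if i.val + j.val + 1 = 1 then (1 : L) else 0)).Adelic) ℂ) :
    {𝒪H : StableClassH (cmConjRingHom L) (Matrix.of fun i j : Fin 2 => if i.val + j.val + 1 = 2 then (1 : L) else 0)
        (Matrix.of fun i j : Fin 1 => if i.val + j.val + 1 = 1 then (1 : L) else 0) |
      ∃ γH : (UnitaryGroup.cmDatum L 2 (Matrix.of fun i j : Fin 2 => if i.val + j.val + 1 = 2 then (1 : L) else 0)).Rational ×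
          (UnitaryGroup.cmDatum L 1 (Matrix.of fun i j : Fin 1 => if i.val + j.val + 1 = 1 then (1 : L) else 0)).Rational,
        stableClassHOf (cmConjRingHom L) _ _ γH = 𝒪H ∧
          IsGRegular (cmConjRingHom L) (Matrix.of fun i j : Fin 2 => if i.val + j.val + 1 = 2 then (1 : L) else 0)
            (Matrix.of fun i j : Fin 1 => if i.val + j.val + 1 = 1 then (1 : L) else 0)
            (Matrix.of fun i j : Fin 3 => if i.val + j.val + 1 = 3 then (1 : L) else 0) endoForm_antidiagOne γH ∧
          adelicStableOrbitalIntegralH L γH m fH ≠ 0}.Finite :=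
  finite_setOf_stableClassH_adelicStableOrbitalIntegralH_ne_zero m fH.hasCompactSupport

end Adelic

end Literature.NumberTheory.Rogawski1990
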